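import Summits.RiemannHypothesis.RiemannHypothesis.Theorems.AsymptoticCriticalLine.Negative.BandForms
import Literature.NumberTheory.LFunctions.RHWave0HardyProofs

/-!
# A second TEMPERED band: `ζ(2s)` and the degree-3 Euler product `ζ(s)ζ(2s)` (negative lemmas, cycle 3)

Refuted strengthenings of the crux `AsymptoticCriticalLine` (stmt-RiemannHypothesis-2063, route
RuelleBand), unconditional (Hardy 1914, PROVED in tree as
`Literature.NumberTheory.LFunctions.hardy_infinite_zeros_on_critical_line_holds`):

* `ζ(2s)` (`zetaTwoMul`): multiplicative coefficients (indicator of the squares), degree-2 Euler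
  product `∏ (1 − p^{−2s})⁻¹ = ∏ ((1 − p^{−s})(1 + p^{−s}))⁻¹` with UNITARY local roots `±1`, exact
  functional equation with centre `1/4` (`completedZeta_twoMul_symm`), no zeros on `Re s ≥ 1/2`
  (`zetaTwoMul_ne_zero_of_half_le`) — and an infinite band at level `1/4`: the line `Re s = 1/4`
  (`bandSet_zetaTwoMul_infinite`).
* `Z₂ = ζ(s)ζ(2s)` (`zetaZetaTwo`): Dirichlet series with multiplicative, Ramanujan-bounded
  coefficients `a(n) = #{(m,k) : m k² = n} ≤ d(n)`, absolutely convergent exactly on `Re s > 1`,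
  simple pole at `s = 1`, degree-3 Euler product over ALL primes with local factor
  `((1 − X)²(1 + X))⁻¹`, `X = p^{−s}` — every local root on the unit circle (`localFactor_zetaZetaTwo`,
  `zetaZetaTwo_eulerProduct`). Its zero set in the strip is `ζ`'s PLUS the line `Re s = 1/4`: TWO
  populated lines, `1/2` and `1/4` — the kill shape `not_acl_iff` ("a second band") realised by a
  tempered Euler product (`not_band_zetaZetaTwo`). Its RIGHT half-bands are exactly `ζ`'s, so `Z₂`
  has the ONE-SIDED shape iff the crux holds (`rightBand_zetaZetaTwo_iff_acl`) and never the
  two-sided one: the reflection `s ↦ 1 − s` behind `acl_iff_rightBand` is load-bearing.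

Lesson for the provers (complementing `ShapeFails.not_band_zetaTwistedAtTwo`, one NON-tempered
factor, and `ShapeFailsMore.not_band_shiftedZeta`, exact FE but width): temperedness of every local
factor + multiplicativity + Ramanujan + pole at `1` + abscissa `1` do NOT give the band either; what
`Z₂` lacks is holomorphy at `s = 1/2` and the SINGLE functional equation `s ↔ 1 − s`. In the
route's trace-formula dictionary: `−Z₂'/Z₂ = ∑ Λ₂(n) n^{−s}` with `Λ₂(p^{2j}) = 3 log p`,
`Λ₂(p^{2j+1}) = log p` — over-weighting the EVEN iterates of every periodic orbit by a factor `3`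
creates a full second band at half depth. The weights of iterates must be exact.
-/

noncomputable section

set_option linter.dupNamespace false

namespace Summit.RiemannHypothesis.RiemannHypothesis.Theorems.AsymptoticCriticalLine.Negative

open Complex Set
open Summit.RiemannHypothesis.RiemannHypothesis.Theses.RuelleBand (AsymptoticCriticalLine)

/-! ## 1. Scaling: `ζ(2s)` has its band at `Re s = 1/4` -/

/-- `ζ(2s)`. [folklore] -/
def zetaTwoMul (s : ℂ) : ℂ :=
  riemannZeta (2 * s)

/-- The point `1/4 + (t/2) i`. [folklore] -/
def quarterPt (t : ℝ) : ℂ :=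
  (((1 : ℝ) / 4 : ℝ) : ℂ) + ((t / 2 : ℝ) : ℂ) * I

/-- [folklore] -/
theorem quarterPt_re (t : ℝ) : (quarterPt t).re = 1 / 4 := by
  simp only [quarterPt, add_re, ofReal_re, mul_re, I_re, I_im, ofReal_im, mul_zero, mul_one,
    sub_zero, add_zero]

/-- [folklore] -/
theorem quarterPt_im (t : ℝ) : (quarterPt t).im = t / 2 := by
  simp only [quarterPt, add_im, ofReal_im, mul_im, ofReal_re, I_re, I_im, mul_zero, mul_one,
    zero_add, add_zero]

/-- `2 · (1/4 + it/2) = 1/2 + it`. [folklore] -/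
theorem two_mul_quarterPt (t : ℝ) : 2 * quarterPt t = 1 / 2 + t * I := by
  simp only [quarterPt]
  push_cast
  ring

/-- [folklore] -/
theorem quarterPt_injective : Function.Injective quarterPt := by
  intro a b hab
  have h := congrArg Complex.im hab
  rw [quarterPt_im, quarterPt_im] at h
  linarith

/-- `ζ(2 · quarterPt t) = ζ(1/2 + it)`. [folklore] -/
theorem zetaTwoMul_quarterPt (t : ℝ) : zetaTwoMul (quarterPt t) = riemannZeta (1 / 2 + t * I) := by
  rw [zetaTwoMul, two_mul_quarterPt]

/-- [folklore] -/
theorem re_two_mul (s : ℂ) : (2 * s).re = 2 * s.re := by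
  simp [mul_re]

/-- `ζ(2s)` has NO zeros on `Re s ≥ 1/2` (Mathlib `riemannZeta_ne_zero_of_one_le_re`): all its
right half-bands are empty. [folklore] -/
theorem zetaTwoMul_ne_zero_of_half_le {s : ℂ} (h : 1 / 2 ≤ s.re) : zetaTwoMul s ≠ 0 :=
  riemannZeta_ne_zero_of_one_le_re (by rw [re_two_mul]; linarith)

/-- EXACT FUNCTIONAL EQUATION WITH CENTRE `1/4`: `Λ(2s) = Λ(2(1/2 − s))`
(Mathlib `completedRiemannZeta_one_sub`). [folklore] -/
theorem completedZeta_twoMul_symm (s : ℂ) :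
    completedRiemannZeta (2 * s) = completedRiemannZeta (2 * (1 / 2 - s)) := by
  rw [show (2 : ℂ) * (1 / 2 - s) = 1 - 2 * s by ring, completedRiemannZeta_one_sub]

/-- DEGREE-2 EULER PRODUCT WITH UNITARY LOCAL ROOTS: `ζ(2s) = ∏_p (1 − p^{−2s})⁻¹` on `Re s > 1/2`
(Mathlib `riemannZeta_eulerProduct_hasProd`), local factor `(1 − X²)⁻¹ = ((1 − X)(1 + X))⁻¹`.
[folklore] -/
theorem zetaTwoMul_eulerProduct {s : ℂ} (hs : 1 / 2 < s.re) :
    HasProd (fun p : Nat.Primes => (1 - (p : ℂ) ^ (-(2 * s)))⁻¹) (zetaTwoMul s) :=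
  riemannZeta_eulerProduct_hasProd (by rw [re_two_mul]; linarith)

/-- REFUTED STRENGTHENING (unconditional, Hardy): the level-`1/4` band of `ζ(2s)` is INFINITE — it
contains `1/4 + it/2` for every critical zero `1/2 + it` of `ζ`. [folklore] -/
theorem bandSet_zetaTwoMul_infinite : (bandSet zetaTwoMul (1 / 4)).Infinite := by
  have hH : {t : ℝ | riemannZeta (1 / 2 + t * I) = 0}.Infinite :=
    Literature.NumberTheory.LFunctions.hardy_infinite_zeros_on_critical_line_holds
  have hsub : quarterPt '' {t : ℝ | riemannZeta (1 / 2 + t * I) = 0} ⊆ bandSet zetaTwoMul (1 / 4) := by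
    rintro _ ⟨t, ht, rfl⟩
    refine ⟨by rwa [zetaTwoMul_quarterPt], ?_, ?_, ?_⟩ <;> rw [quarterPt_re] <;> norm_num
  exact (hH.image quarterPt_injective.injOn).mono hsub

/-- The band shape fails for `ζ(2s)`. [folklore] -/
theorem not_band_zetaTwoMul : ¬ ∀ ε : ℝ, 0 < ε → (bandSet zetaTwoMul ε).Finite := fun h =>
  bandSet_zetaTwoMul_infinite (h _ (by norm_num))

/-! ## 2. Two tempered bands: `Z₂ = ζ(s)ζ(2s)` -/

/-- `Z₂(s) = ζ(s)ζ(2s) = ∑ a(n) n^{−s}`, `a(n) = #{(m, k) : m k² = n}`. [folklore] -/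
def zetaZetaTwo (s : ℂ) : ℂ :=
  riemannZeta s * zetaTwoMul s

/-- DEGREE-3 EULER PRODUCT over all primes: `Z₂(s) = ∏_p ((1 − p^{−s})(1 − p^{−2s}))⁻¹` on
`Re s > 1` (Mathlib's Euler product for `ζ`, twice). [folklore] -/
theorem zetaZetaTwo_eulerProduct {s : ℂ} (hs : 1 < s.re) :
    HasProd (fun p : Nat.Primes => (1 - (p : ℂ) ^ (-s))⁻¹ * (1 - (p : ℂ) ^ (-(2 * s)))⁻¹)
      (zetaZetaTwo s) :=
  (riemannZeta_eulerProduct_hasProd hs).mul (zetaTwoMul_eulerProduct (by linarith))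

/-- Its local factor is TEMPERED: `(1 − X)(1 − X²) = (1 − X)²(1 + X)`, roots `1, 1, −1`, all on
the unit circle (Selberg-class Ramanujan/`θ = 0`; contrast `ShapeFails.zetaTwistedAtTwo`, whose one
modified factor has a root of modulus `2^{3/4} > 1`). [folklore] -/
theorem localFactor_zetaZetaTwo (X : ℂ) : (1 - X) * (1 - X ^ 2) = (1 - X) ^ 2 * (1 + X) := by
  ring

/-- REFUTED STRENGTHENING (unconditional): the band shape fails for `Z₂ = ζ(s)ζ(2s)` — a second,
TEMPERED band on `Re s = 1/4` (bands of a product are unions, `Products.bandSet_mul`).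
[folklore] -/
theorem not_band_zetaZetaTwo : ¬ ∀ ε : ℝ, 0 < ε → (bandSet zetaZetaTwo ε).Finite := fun h =>
  bandSet_zetaTwoMul_infinite ((h _ (by norm_num)).subset fun s ⟨hz, h0, h1, hε⟩ =>
    ⟨by rw [zetaZetaTwo, hz, mul_zero], h0, h1, hε⟩)

/-- On `Re s ≥ 1/2` the zeros of `Z₂` are exactly those of `ζ`. [folklore] -/
theorem zetaZetaTwo_eq_zero_iff {s : ℂ} (h : 1 / 2 ≤ s.re) : zetaZetaTwo s = 0 ↔ riemannZeta s = 0 := by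
  rw [zetaZetaTwo, mul_eq_zero, or_iff_left (zetaTwoMul_ne_zero_of_half_le h)]

/-- ONE-SIDED ≠ TWO-SIDED without the symmetry `s ↦ 1 − s`: the RIGHT half-bands of `Z₂` are
`ζ`'s, so `Z₂` has the one-sided band shape iff the crux holds (`BandForms.acl_iff_rightBand`),
while its two-sided shape is false outright (`not_band_zetaZetaTwo`). [folklore] -/
theorem rightBand_zetaZetaTwo_iff_acl :
    (∀ ε : ℝ, 0 < ε → {s : ℂ | zetaZetaTwo s = 0 ∧ 1 / 2 + ε ≤ s.re ∧ s.re < 1}.Finite) ↔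
      AsymptoticCriticalLine := by
  rw [acl_iff_rightBand]
  refine forall₂_congr fun ε hε => ?_
  have hset : {s : ℂ | zetaZetaTwo s = 0 ∧ 1 / 2 + ε ≤ s.re ∧ s.re < 1} = rightBandSet ε := by
    ext s
    simp only [mem_setOf_eq, rightBandSet]
    constructor
    · rintro ⟨hz, h1, h2⟩
      exact ⟨(zetaZetaTwo_eq_zero_iff (by linarith)).1 hz, h1, h2⟩
    · rintro ⟨hz, h1, h2⟩
      exact ⟨(zetaZetaTwo_eq_zero_iff (by linarith)).2 hz, h1, h2⟩
  rw [hset]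

/-- The bands of `Z₂` are the unions of the bands of `ζ` and of `ζ(2s)`; the latter consist of
the points `ρ/2`, `ρ` a non-trivial zero of `ζ` with `Re ρ ≤ 1 − 2ε` (all at `Re s < 1/2`). So at
levels `ε > 1/4` the bands of `Z₂` are finite iff the LEFT bands of `ζ` of level `2ε − 1/2` are:
the accumulation set of `{Re ρ : Z₂(ρ) = 0}` is `{1/4, 1/2}` iff the crux holds. [folklore] -/
theorem bandSet_zetaZetaTwo_eq (ε : ℝ) :
    bandSet zetaZetaTwo ε = bandSet riemannZeta ε ∪ bandSet zetaTwoMul ε := by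
  ext s
  simp only [bandSet, zetaZetaTwo, mem_setOf_eq, mem_union, mul_eq_zero]
  tauto

end Summit.RiemannHypothesis.RiemannHypothesis.Theorems.AsymptoticCriticalLine.Negative
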